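import Mathlib
import HarnessLib
import Literature.Analysis.FluidPDE.SelfSimilar
import Literature.Analysis.FluidPDE.VectorCalculus
import Literature.Analysis.FluidPDE.RadialCalculus
import Literature.Analysis.FluidPDE.ClassicalSolutionGalilean
import Literature.Analysis.FluidPDE.KNSSRegularityGalilean
import Literature.Analysis.FluidPDE.LerayProfileCalculus
import Literature.Analysis.FluidPDE.ClassicalSolution
import Literature.Analysis.FluidPDE.ClassicalSolutionCalculus
import Literature.Analysis.FluidPDE.SpaceTimeCalculus
import Literature.Analysis.FluidPDE.TaoEnstrophyLocalisation
import Literature.Analysis.UnboundedOperators.HeatKernel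
import Literature.Analysis.FluidPDE.NSBoundedMildOseen

/-!
# K2 line `slicesharp-screw`, stub L4 `stub_decayingSlopeLiouville` — file 1/4: THE RADIAL BARRIER
# `Ψ(y) = e[(‖y − x₀‖² + m)^{1/2} + k]` (gradient `≤ e`, Laplacian `≤ 3e/√m`, smoothness) and its clock

Cell ns-regularity-ideate, K2 lead nsreg-p7 (CENSUS-K2G §12, M8 «decaying-slope barrier»; helper file, `--supports
stmt-NavierStokesRegularity-19708 --as helper`).  Radial calculus from the tree's `laplacian_comp_norm_sq`
(`Δ(‖·‖²+m)^{1/2} = −‖z‖²/((‖z‖²+m)^{3/2}) + 3/(‖z‖²+m)^{1/2} ≤ 3/√m` in dimension 3), translation by `laplacian_comp_sub_right`,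
and the clock `k(t) = 4C(√(−t₀) − √(−t)) + q(t − t₀)` with `k′ = 2C/√(−t) + q`.

WHAT THIS IS NOT: not a claim about Navier–Stokes regularity — calculus for one registered stub of the K2 line of a door route
(bears_on LADDER-NS N0, rung N0-LocalTubeDoorPoloidal).
-/

noncomputable section

set_option linter.dupNamespace false

namespace Summit.NavierStokesRegularity.NavierStokesRegularity.Theorems.PoloidalWindowDoorPoloidalWindowRigidityDecayingSlopeLiouvilleBarrier

open Set Function Filter Topology Metric InnerProductSpace MeasureTheory
open scoped RealInnerProductSpace Laplacian
open Literature.Analysis Literature.Analysis.FluidPDE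

/-! ### Part A — the radial barrier `(‖x − x₀‖² + m)^{1/2}` -/

/-- The profile `g(σ) = √(σ + m)` has derivative `1/(2√(σ+m))` at every `σ > −m`. -/
theorem hasDerivAt_sqrt_add {m σ : ℝ} (h : 0 < σ + m) :
    HasDerivAt (fun s => Real.sqrt (s + m)) (1 / (2 * Real.sqrt (σ + m))) σ := by
  have h1 : HasDerivAt (fun s => s + m) 1 σ := (hasDerivAt_id σ).add_const m
  have h2 := (Real.hasDerivAt_sqrt h.ne').comp σ h1
  have h3 : (Real.sqrt ∘ fun s => s + m) = fun s => Real.sqrt (s + m) := rfl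
  rw [h3, mul_one] at h2
  exact h2

/-- The derivative profile `g₁(σ) = 1/(2√(σ+m))` has derivative `−1/(4 (σ+m) √(σ+m))` at `σ > −m`. -/
theorem hasDerivAt_inv_two_sqrt_add {m σ : ℝ} (h : 0 < σ + m) :
    HasDerivAt (fun s => 1 / (2 * Real.sqrt (s + m))) (-1 / (4 * (σ + m) * Real.sqrt (σ + m))) σ := by
  have hs : 0 < Real.sqrt (σ + m) := Real.sqrt_pos.2 h
  have h1 : HasDerivAt (fun s => 2 * Real.sqrt (s + m)) (2 * (1 / (2 * Real.sqrt (σ + m)))) σ :=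
    (hasDerivAt_sqrt_add h).const_mul 2
  have h2 := h1.inv (by positivity)
  have h3 : (fun s => 1 / (2 * Real.sqrt (s + m))) = fun s => (2 * Real.sqrt (s + m))⁻¹ := by
    funext s; rw [one_div]
  rw [h3]
  refine h2.congr_deriv ?_
  have hsq : Real.sqrt (σ + m) ^ 2 = σ + m := Real.sq_sqrt h.le
  field_simp
  rw [hsq]
  ring

/-- **Gradient of the radial barrier**: `D[(‖·‖² + m)^{1/2}](z) = (√(‖z‖²+m))⁻¹ ⟨z, ·⟩`, of norm `≤ 1` (`m > 0`). -/
theorem hasFDerivAt_sqrt_norm_sq_add {m : ℝ} (hm : 0 < m) (z : (EuclideanSpace ℝ (Fin 3))) :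
    HasFDerivAt (fun w : (EuclideanSpace ℝ (Fin 3)) => Real.sqrt (‖w‖ ^ 2 + m))
      ((2 * (1 / (2 * Real.sqrt (‖z‖ ^ 2 + m)))) • (innerSL ℝ z : (EuclideanSpace ℝ (Fin 3)) →L[ℝ] ℝ)) z :=
  hasFDerivAt_comp_norm_sq (g := fun s => Real.sqrt (s + m)) (hasDerivAt_sqrt_add (by positivity))

/-- The gradient of the radial barrier has norm at most `1`. -/
theorem norm_fderiv_sqrt_norm_sq_add_le {m : ℝ} (hm : 0 < m) (z : (EuclideanSpace ℝ (Fin 3))) :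
    ‖fderiv ℝ (fun w : (EuclideanSpace ℝ (Fin 3)) => Real.sqrt (‖w‖ ^ 2 + m)) z‖ ≤ 1 := by
  rw [(hasFDerivAt_sqrt_norm_sq_add hm z).fderiv]
  have hs : 0 < Real.sqrt (‖z‖ ^ 2 + m) := Real.sqrt_pos.2 (by positivity)
  have hcoef : 2 * (1 / (2 * Real.sqrt (‖z‖ ^ 2 + m))) = (Real.sqrt (‖z‖ ^ 2 + m))⁻¹ := by
    field_simp
  rw [hcoef]
  refine ContinuousLinearMap.opNorm_le_bound _ zero_le_one fun v => ?_
  rw [show ((Real.sqrt (‖z‖ ^ 2 + m))⁻¹ • (innerSL ℝ z : (EuclideanSpace ℝ (Fin 3)) →L[ℝ] ℝ)) v =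
      (Real.sqrt (‖z‖ ^ 2 + m))⁻¹ • ((innerSL ℝ z : (EuclideanSpace ℝ (Fin 3)) →L[ℝ] ℝ) v) from rfl,
    innerSL_real_coe_apply_apply, smul_eq_mul, norm_mul, norm_inv,
    Real.norm_of_nonneg hs.le, one_mul]
  have hz : ‖z‖ ≤ Real.sqrt (‖z‖ ^ 2 + m) := by
    rw [← Real.sqrt_sq (norm_nonneg z)]
    exact Real.sqrt_le_sqrt (by rw [Real.sqrt_sq (norm_nonneg z)]; linarith)
  calc (Real.sqrt (‖z‖ ^ 2 + m))⁻¹ * ‖⟪z, v⟫‖ ≤ (Real.sqrt (‖z‖ ^ 2 + m))⁻¹ * (‖z‖ * ‖v‖) :=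
        mul_le_mul_of_nonneg_left (norm_inner_le_norm z v) (inv_nonneg.2 hs.le)
    _ ≤ (Real.sqrt (‖z‖ ^ 2 + m))⁻¹ * (Real.sqrt (‖z‖ ^ 2 + m) * ‖v‖) :=
        mul_le_mul_of_nonneg_left (mul_le_mul_of_nonneg_right hz (norm_nonneg _)) (inv_nonneg.2 hs.le)
    _ = ‖v‖ := by field_simp

/-- **Laplacian of the radial barrier** (dimension 3): `Δ(‖·‖²+m)^{1/2}(z) = −‖z‖²/((‖z‖²+m)√(‖z‖²+m)) + 3/√(‖z‖²+m)`. -/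
theorem laplacian_sqrt_norm_sq_add {m : ℝ} (hm : 0 < m) (z : (EuclideanSpace ℝ (Fin 3))) :
    (Δ (fun w : (EuclideanSpace ℝ (Fin 3)) => Real.sqrt (‖w‖ ^ 2 + m))) z =
      4 * (-1 / (4 * (‖z‖ ^ 2 + m) * Real.sqrt (‖z‖ ^ 2 + m))) * ‖z‖ ^ 2 +
        2 * (3 : ℕ) * (1 / (2 * Real.sqrt (‖z‖ ^ 2 + m))) := by
  have h := laplacian_comp_norm_sq (E := (EuclideanSpace ℝ (Fin 3))) (g := fun s => Real.sqrt (s + m))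
    (g₁ := fun s => 1 / (2 * Real.sqrt (s + m))) (U := Ioi (-m)) isOpen_Ioi
    (fun σ hσ => hasDerivAt_sqrt_add (by simpa using neg_lt_iff_pos_add.1 hσ)) (z := z)
    (by rw [mem_Ioi]; linarith [sq_nonneg ‖z‖])
    (hasDerivAt_inv_two_sqrt_add (by positivity))
  rw [h, finrank_euclideanSpace, Fintype.card_fin]

/-- The Laplacian of the radial barrier is at most `3/√m`. -/
theorem laplacian_sqrt_norm_sq_add_le {m : ℝ} (hm : 0 < m) (z : (EuclideanSpace ℝ (Fin 3))) :
    (Δ (fun w : (EuclideanSpace ℝ (Fin 3)) => Real.sqrt (‖w‖ ^ 2 + m))) z ≤ 3 / Real.sqrt m := by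
  rw [laplacian_sqrt_norm_sq_add hm z]
  have hs : 0 < Real.sqrt (‖z‖ ^ 2 + m) := Real.sqrt_pos.2 (by positivity)
  have hsm : Real.sqrt m ≤ Real.sqrt (‖z‖ ^ 2 + m) := Real.sqrt_le_sqrt (by nlinarith [sq_nonneg ‖z‖])
  have hm' : 0 < Real.sqrt m := Real.sqrt_pos.2 hm
  have h1 : 4 * (-1 / (4 * (‖z‖ ^ 2 + m) * Real.sqrt (‖z‖ ^ 2 + m))) * ‖z‖ ^ 2 ≤ 0 := by
    have : 0 ≤ ‖z‖ ^ 2 / ((‖z‖ ^ 2 + m) * Real.sqrt (‖z‖ ^ 2 + m)) := by positivity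
    have heq : 4 * (-1 / (4 * (‖z‖ ^ 2 + m) * Real.sqrt (‖z‖ ^ 2 + m))) * ‖z‖ ^ 2 =
        -(‖z‖ ^ 2 / ((‖z‖ ^ 2 + m) * Real.sqrt (‖z‖ ^ 2 + m))) := by
      field_simp
    linarith
  have h2 : 2 * ((3 : ℕ) : ℝ) * (1 / (2 * Real.sqrt (‖z‖ ^ 2 + m))) = 3 / Real.sqrt (‖z‖ ^ 2 + m) := by
    push_cast
    field_simp
  rw [h2]
  have h3 : 3 / Real.sqrt (‖z‖ ^ 2 + m) ≤ 3 / Real.sqrt m :=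
    div_le_div_of_nonneg_left (by norm_num) hm' hsm
  linarith

/-- The radial barrier is `C^∞` (in particular `C²`) for `m > 0`. -/
theorem contDiff_sqrt_norm_sq_add {m : ℝ} (hm : 0 < m) {n : WithTop ℕ∞} :
    ContDiff ℝ n (fun w : (EuclideanSpace ℝ (Fin 3)) => Real.sqrt (‖w‖ ^ 2 + m)) := by
  refine ContDiff.sqrt ?_ fun w => ?_
  · exact (contDiff_norm_sq ℝ).add contDiff_const
  · positivity

/-- Lower bound: `(‖z‖²+m)^{1/2} ≥ ‖z‖`. -/
theorem norm_le_sqrt_norm_sq_add {m : ℝ} (hm : 0 ≤ m) (z : (EuclideanSpace ℝ (Fin 3))) : ‖z‖ ≤ Real.sqrt (‖z‖ ^ 2 + m) := by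
  rw [← Real.sqrt_sq (norm_nonneg z)]
  exact Real.sqrt_le_sqrt (by rw [Real.sqrt_sq (norm_nonneg z)]; linarith)

/-- Upper bound: `(‖z‖²+m)^{1/2} ≤ ‖z‖ + √m`. -/
theorem sqrt_norm_sq_add_le {m : ℝ} (hm : 0 ≤ m) (z : (EuclideanSpace ℝ (Fin 3))) :
    Real.sqrt (‖z‖ ^ 2 + m) ≤ ‖z‖ + Real.sqrt m := by
  rw [Real.sqrt_le_left (by positivity)]
  nlinarith [Real.sq_sqrt hm, Real.sqrt_nonneg m, norm_nonneg z]

/-! ### The barrier slice `y ↦ e(√(‖y−x₀‖²+m) + k)` -/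

/-- Laplacian of the barrier slice `x ↦ e (√(‖x − x₀‖² + m) + k)`: `= e Δ√(‖· − x₀‖²+m)(x) ≤ 3e/√m` (`e ≥ 0`, `m > 0`). -/
theorem laplacian_barrier_le {m e k : ℝ} (hm : 0 < m) (he : 0 ≤ e) (x₀ x : (EuclideanSpace ℝ (Fin 3))) :
    (Δ (fun y : (EuclideanSpace ℝ (Fin 3)) => e * (Real.sqrt (‖y - x₀‖ ^ 2 + m) + k))) x ≤ e * (3 / Real.sqrt m) := by
  have hf : ContDiff ℝ 2 (fun y : (EuclideanSpace ℝ (Fin 3)) => Real.sqrt (‖y - x₀‖ ^ 2 + m)) :=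
    (contDiff_sqrt_norm_sq_add hm).comp (contDiff_id.sub contDiff_const)
  set F : (EuclideanSpace ℝ (Fin 3)) → ℝ := fun y => Real.sqrt (‖y - x₀‖ ^ 2 + m) with hF
  set K : (EuclideanSpace ℝ (Fin 3)) → ℝ := fun _ => k with hK
  have h1 : (fun y : (EuclideanSpace ℝ (Fin 3)) => e * (Real.sqrt (‖y - x₀‖ ^ 2 + m) + k)) = e • (F + K) := by
    funext y; simp [hF, hK, smul_eq_mul]
  have hFK : ContDiff ℝ 2 (F + K) := hf.add contDiff_const
  rw [h1, InnerProductSpace.laplacian_smul e hFK.contDiffAt]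
  have h2 : (Δ (F + K)) x = (Δ F) x := by
    rw [(hf.contDiffAt).laplacian_add contDiffAt_const]
    have h0 : (Δ K) x = 0 := laplacian_const_eq_zero k x
    rw [h0, add_zero]
  rw [h2, smul_eq_mul]
  refine mul_le_mul_of_nonneg_left ?_ he
  have h3 : (Δ (fun y : (EuclideanSpace ℝ (Fin 3)) => Real.sqrt (‖y - x₀‖ ^ 2 + m))) x =
      (Δ (fun w : (EuclideanSpace ℝ (Fin 3)) => Real.sqrt (‖w‖ ^ 2 + m))) (x - x₀) := by
    have := laplacian_comp_sub_right (fun w : (EuclideanSpace ℝ (Fin 3)) => Real.sqrt (‖w‖ ^ 2 + m)) x₀ x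
    simpa using this
  rw [h3]
  exact laplacian_sqrt_norm_sq_add_le hm _

/-- Gradient of the barrier slice: `‖D[e(√(‖·−x₀‖²+m) + k)](x)‖ ≤ e` (`e ≥ 0`, `m > 0`). -/
theorem norm_fderiv_barrier_le {m e k : ℝ} (hm : 0 < m) (he : 0 ≤ e) (x₀ x : (EuclideanSpace ℝ (Fin 3))) :
    ‖fderiv ℝ (fun y : (EuclideanSpace ℝ (Fin 3)) => e * (Real.sqrt (‖y - x₀‖ ^ 2 + m) + k)) x‖ ≤ e := by
  have hf2 : ContDiff ℝ 1 (fun y : (EuclideanSpace ℝ (Fin 3)) => Real.sqrt (‖y - x₀‖ ^ 2 + m)) :=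
    (contDiff_sqrt_norm_sq_add hm).comp (contDiff_id.sub contDiff_const)
  have hf : DifferentiableAt ℝ (fun y : (EuclideanSpace ℝ (Fin 3)) => Real.sqrt (‖y - x₀‖ ^ 2 + m)) x :=
    hf2.differentiable one_ne_zero x
  have h1 : fderiv ℝ (fun y : (EuclideanSpace ℝ (Fin 3)) => e * (Real.sqrt (‖y - x₀‖ ^ 2 + m) + k)) x =
      e • fderiv ℝ (fun y : (EuclideanSpace ℝ (Fin 3)) => Real.sqrt (‖y - x₀‖ ^ 2 + m)) x := by
    rw [fderiv_const_mul (hf.add_const k) e, fderiv_add_const]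
  rw [h1, norm_smul, Real.norm_of_nonneg he]
  refine mul_le_of_le_one_right he ?_
  have h2 : fderiv ℝ (fun y : (EuclideanSpace ℝ (Fin 3)) => Real.sqrt (‖y - x₀‖ ^ 2 + m)) x =
      fderiv ℝ (fun w : (EuclideanSpace ℝ (Fin 3)) => Real.sqrt (‖w‖ ^ 2 + m)) (x - x₀) := by
    have := fderiv_comp_sub_right (fun w : (EuclideanSpace ℝ (Fin 3)) => Real.sqrt (‖w‖ ^ 2 + m)) x₀ x
    simpa using this
  rw [h2]
  exact norm_fderiv_sqrt_norm_sq_add_le hm _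


/-! ### Part D — more barrier bookkeeping -/


/-- `fderiv` of the barrier slice: `D[e(√(‖·−x₀‖²+m) + k)](x) = e • D[√(‖·−x₀‖²+m)](x)`. -/
theorem fderiv_barrier_eq {m e k : ℝ} (hm : 0 < m) (x₀ x : (EuclideanSpace ℝ (Fin 3))) :
    fderiv ℝ (fun y : (EuclideanSpace ℝ (Fin 3)) => e * (Real.sqrt (‖y - x₀‖ ^ 2 + m) + k)) x =
      e • fderiv ℝ (fun y : (EuclideanSpace ℝ (Fin 3)) => Real.sqrt (‖y - x₀‖ ^ 2 + m)) x := by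
  have hf2 : ContDiff ℝ 1 (fun y : (EuclideanSpace ℝ (Fin 3)) => Real.sqrt (‖y - x₀‖ ^ 2 + m)) :=
    (contDiff_sqrt_norm_sq_add hm).comp (contDiff_id.sub contDiff_const)
  have hf : DifferentiableAt ℝ (fun y : (EuclideanSpace ℝ (Fin 3)) => Real.sqrt (‖y - x₀‖ ^ 2 + m)) x :=
    hf2.differentiable one_ne_zero x
  rw [fderiv_const_mul (hf.add_const k) e, fderiv_add_const]

/-- Laplacian of the barrier slice: `Δ[e(√(‖·−x₀‖²+m) + k)](x) = e Δ[√(‖·−x₀‖²+m)](x)`. -/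
theorem laplacian_barrier_eq {m e k : ℝ} (hm : 0 < m) (x₀ x : (EuclideanSpace ℝ (Fin 3))) :
    (Δ (fun y : (EuclideanSpace ℝ (Fin 3)) => e * (Real.sqrt (‖y - x₀‖ ^ 2 + m) + k))) x =
      e * (Δ (fun y : (EuclideanSpace ℝ (Fin 3)) => Real.sqrt (‖y - x₀‖ ^ 2 + m))) x := by
  have hf : ContDiff ℝ 2 (fun y : (EuclideanSpace ℝ (Fin 3)) => Real.sqrt (‖y - x₀‖ ^ 2 + m)) :=
    (contDiff_sqrt_norm_sq_add hm).comp (contDiff_id.sub contDiff_const)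
  set F : (EuclideanSpace ℝ (Fin 3)) → ℝ := fun y => Real.sqrt (‖y - x₀‖ ^ 2 + m) with hF
  set K : (EuclideanSpace ℝ (Fin 3)) → ℝ := fun _ => k with hK
  have h1 : (fun y : (EuclideanSpace ℝ (Fin 3)) => e * (Real.sqrt (‖y - x₀‖ ^ 2 + m) + k)) = e • (F + K) := by
    funext y; simp [hF, hK, smul_eq_mul]
  have hFK : ContDiff ℝ 2 (F + K) := hf.add contDiff_const
  rw [h1, InnerProductSpace.laplacian_smul e hFK.contDiffAt]
  have h2 : (Δ (F + K)) x = (Δ F) x := by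
    rw [(hf.contDiffAt).laplacian_add contDiffAt_const]
    have h0 : (Δ K) x = 0 := laplacian_const_eq_zero k x
    rw [h0, add_zero]
  rw [h2, smul_eq_mul]

/-- The barrier slice is `C²` (indeed smooth) for `m > 0`. -/
theorem contDiff_barrier {m e k : ℝ} (hm : 0 < m) (x₀ : (EuclideanSpace ℝ (Fin 3))) {n : WithTop ℕ∞} :
    ContDiff ℝ n (fun y : (EuclideanSpace ℝ (Fin 3)) => e * (Real.sqrt (‖y - x₀‖ ^ 2 + m) + k)) :=
  contDiff_const.mul (((contDiff_sqrt_norm_sq_add hm).comp (contDiff_id.sub contDiff_const)).add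
    contDiff_const)

/-- Subtracting a constant does not change the Laplacian of a `C²` function. -/
theorem laplacian_sub_const' {f : (EuclideanSpace ℝ (Fin 3)) → ℝ} (hf : ContDiff ℝ 2 f) (c : ℝ) (x : (EuclideanSpace ℝ (Fin 3))) :
    (Δ (fun y => f y - c)) x = (Δ f) x := by
  have h1 : (fun y => f y - c) = f + fun _ => -c := by funext y; simp [sub_eq_add_neg]
  rw [h1, (hf.contDiffAt).laplacian_add contDiffAt_const]
  have h0 : (Δ fun _ : (EuclideanSpace ℝ (Fin 3)) => -c) x = 0 := laplacian_const_eq_zero (-c) x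
  rw [h0, add_zero]

/-- Time derivative of the barrier clock `k(t) = 4C(√(−t₀) − √(−t)) + q (t − t₀)` at `t < 0`:
`k′(t) = 2C/√(−t) + q`. -/
theorem hasDerivAt_clock (C q t₀ : ℝ) {t : ℝ} (ht : t < 0) :
    HasDerivAt (fun τ => 4 * C * (Real.sqrt (-t₀) - Real.sqrt (-τ)) + q * (τ - t₀))
      (2 * C / Real.sqrt (-t) + q) t := by
  have hnt : 0 < -t := neg_pos.2 ht
  have h1 : HasDerivAt (fun τ : ℝ => Real.sqrt (-τ)) (1 / (2 * Real.sqrt (-t)) * (-1)) t :=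
    (Real.hasDerivAt_sqrt hnt.ne').comp t (hasDerivAt_neg t)
  have h2 : HasDerivAt (fun τ : ℝ => 4 * C * (Real.sqrt (-t₀) - Real.sqrt (-τ)))
      (4 * C * (0 - 1 / (2 * Real.sqrt (-t)) * (-1))) t :=
    ((hasDerivAt_const t _).sub h1).const_mul (4 * C)
  have h3 : HasDerivAt (fun τ : ℝ => q * (τ - t₀)) (q * 1) t :=
    ((hasDerivAt_id t).sub_const t₀).const_mul q
  have h4 := h2.add h3
  refine h4.congr_deriv ?_
  have hs : Real.sqrt (-t) ≠ 0 := (Real.sqrt_pos.2 hnt).ne'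
  field_simp
  ring


end Summit.NavierStokesRegularity.NavierStokesRegularity.Theorems.PoloidalWindowDoorPoloidalWindowRigidityDecayingSlopeLiouvilleBarrier

end
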